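import Mathlib
import Literature.Analysis.UnboundedOperators.ConjugateOperatorRegularity
import Literature.Analysis.UnboundedOperators.UnitaryRepSpectralMeasure
import Literature.Analysis.UnboundedOperators.FourierSpectrumCalculus
import HarnessLib

/-!
# Stub `stub_mourreThresholdLAP` — Mourre LAP infrastructure 1/4: the spectral dictionary

Item `stmt-AtomisticToContinuum-12594` (crux `MourreDissolution` of route `EmbeddedDrudeMourre`,
sub-problem `FouriersLaw`), line `separable-vertex-faddeev-pair-sector`, stub S6
`stub_mourreThresholdLAP` = the limiting absorption principle of Mourre theory (ABG Thm 7.4.1 in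
its gap-free `𝒞^{1,1}` form, Sahbani 1997, plus the virial theorem ABG Prop. 7.2.10) over the
tree's vocabulary (`OneParameterUnitaryGroup`, `fourierCalculus`, `HasMourreEstimateOn`,
`HamiltonianOfClassC1/C11`, `spectralMeasure`). The theorem itself is NOT in the tree; these files
(`…LAPSpectralDictionary`, `…LAPVirial`, `…LAPCalculus`, `…LAPLocalisation`) are the sorry-free
bottom of the chain (Mourre LAP infrastructure), reusable by every consumer of the abstract
Mourre `⇒` LAP statement (e.g. route `MourreKoopmanCharges` of `HydrodynamicLimit`).

This file (part 1, carries all the definitions):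

* §1 the spectral (Stone–Bochner) form of the Laplace–Fourier transform of a matrix coefficient:
  `specMeasure U ψ = μ_ψ` with `⟪ψ, U_t ψ⟫ = ∫ e^{iξt} dμ_ψ(ξ)`, and (Fubini)
  `∫₀^∞ e^{-νt} e^{-iωt} ⟪ψ, U_t ψ⟫ dt = ∫ dμ_ψ(ξ) / (ν + i(ω - ξ))`, whose real part is the
  Poisson integral `∫ ν / (ν² + (ω - ξ)²) dμ_ψ(ξ)` centred at `ω` (the object stub S3 consumes);
* §2 `laplaceFourier U ψ ν ω` (the function in the stub's conclusion) and the reductions of the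
  conclusion: each `G_ν` is continuous with `‖G_ν‖ ≤ ‖ψ‖²/ν`, `ContinuousOn G` is automatic for a
  uniform limit, and the registered statement follows verbatim from the uniform Cauchy property
  of `ν ↦ G_ν` on `[l', r']` as `ν ↓ 0` (`stub_of_uniformCauchy`);
* §3 the resolvent kernel `k_z(t) = -i e^{-izt} 𝟙_{t ≥ 0}` (`Im z < 0`) and the bounded operator
  `resolventAt U z = ∫ k_z(t) U(t) dt = (H - z)⁻¹` (the tree's `resolventNegI` is `z = -i`); its
  calculus is in part 3 (`…LAPCalculus`).

Mathlib's inner product is conjugate-linear in the first variable, so `⟪ψ, U_t ψ⟫ = ∫ e^{+iξt} dμ_ψ`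
and the resonance of `∫₀^∞ e^{-νt} e^{-iωt} ⟪ψ, U_t ψ⟫ dt` sits at the spectral value `ξ = ω`.
-/

noncomputable section

open MeasureTheory Complex Filter Topology Set
open scoped InnerProductSpace ComplexConjugate SchwartzMap FourierTransform ENNReal NNReal

namespace Summit.AtomisticToContinuum.FouriersLaw.Theorems.MourreDissolution

open Literature.Analysis.UnboundedOperators
open Literature.Analysis.UnboundedOperators.UnitaryRep

variable {H : Type*} [NormedAddCommGroup H] [InnerProductSpace ℂ H] [CompleteSpace H]

/-! ## §1. The spectral form of the Laplace–Fourier transform of a matrix coefficient -/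

/-- The bilinear form `B ξ x = ξ x` on `ℝ`, identifying `ℝ` with its dual. [folklore] -/
def mulForm : LinearMap.BilinForm ℝ ℝ := LinearMap.mul ℝ ℝ

/-- `mulForm ξ x = ξ x`. [folklore] -/
@[simp] theorem mulForm_apply (ξ x : ℝ) : mulForm ξ x = ξ * x := rfl

/-- `B ξ x = ξ x` is non-degenerate. [folklore] -/
theorem mulForm_nondegenerate : mulForm.Nondegenerate := by
  refine ⟨fun x hx => ?_, fun y hy => ?_⟩
  · simpa using hx 1
  · simpa using hy 1

/-- The Stone–Bochner spectral measure `μ_ψ` of `ψ` for the one-parameter unitary group `U` on `ℝ`: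
the finite measure with `⟪ψ, U_t ψ⟫ = ∫ e^{iξt} dμ_ψ(ξ)`. [folklore] -/
def specMeasure (U : OneParameterUnitaryGroup H) (ψ : H) : Measure ℝ :=
  U.spectralMeasure mulForm mulForm_nondegenerate ψ

/-- `μ_ψ` is a finite measure (total mass `‖ψ‖²`). [folklore] -/
instance isFiniteMeasure_specMeasure (U : OneParameterUnitaryGroup H) (ψ : H) :
    IsFiniteMeasure (specMeasure U ψ) := by
  unfold specMeasure; infer_instance

/-- `⟪ψ, U_t ψ⟫ = ∫ e^{iξt} dμ_ψ(ξ)`. [folklore] -/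
theorem inner_appReal_eq_integral_specMeasure (U : OneParameterUnitaryGroup H) (ψ : H) (t : ℝ) :
    ⟪ψ, U.appReal t ψ⟫_ℂ = ∫ ξ, cexp (((ξ * t : ℝ) : ℂ) * I) ∂(specMeasure U ψ) := by
  have h := U.inner_map_eq_integral_spectralMeasure mulForm mulForm_nondegenerate ψ t
  simpa [specMeasure, appReal] using h

/-- The total mass of `μ_ψ` is `‖ψ‖²`. [folklore] -/
theorem specMeasure_real_univ (U : OneParameterUnitaryGroup H) (ψ : H) :
    (specMeasure U ψ).real univ = ‖ψ‖ ^ 2 :=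
  U.spectralMeasure_real_univ mulForm mulForm_nondegenerate ψ

/-- The elementary Laplace integral: for `ν > 0`,
`∫₀^∞ e^{-νt} e^{-iωt} e^{iξt} dt = 1 / (ν + i(ω - ξ))`. [folklore] -/
theorem integral_Ioi_exp_neg_mul_cexp (ν ω ξ : ℝ) (hν : 0 < ν) :
    ∫ t in Ioi (0:ℝ), ((Real.exp (-(ν * t)) : ℝ) : ℂ) * cexp (-(I * ((ω * t : ℝ) : ℂ))) *
        cexp (((ξ * t : ℝ) : ℂ) * I) = 1 / ((ν : ℂ) + I * ((ω - ξ : ℝ) : ℂ)) := by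
  set a : ℂ := -(ν : ℂ) - I * ((ω - ξ : ℝ) : ℂ) with ha
  have hare : a.re < 0 := by
    simp [ha, hν]
  have hpt : ∀ t : ℝ, ((Real.exp (-(ν * t)) : ℝ) : ℂ) * cexp (-(I * ((ω * t : ℝ) : ℂ))) *
      cexp (((ξ * t : ℝ) : ℂ) * I) = cexp (a * t) := by
    intro t
    rw [Complex.ofReal_exp, ← Complex.exp_add, ← Complex.exp_add]
    congr 1
    simp only [ha]
    push_cast
    ring
  simp_rw [hpt]
  rw [integral_exp_mul_complex_Ioi hare 0]
  have hane : a ≠ 0 := fun h => by rw [h] at hare; simp at hare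
  rw [Complex.ofReal_zero, mul_zero, Complex.exp_zero]
  rw [show (ν : ℂ) + I * ((ω - ξ : ℝ) : ℂ) = -a by simp [ha]; ring]
  field_simp


/-- The two-variable integrand `e^{-νt} e^{-iωt} e^{iξt}` is integrable on `(0, ∞) × (ℝ, μ)` for a
finite measure `μ` and `ν > 0` (its norm is `e^{-νt}`). [folklore] -/
theorem integrable_laplace_kernel_prod (μ : Measure ℝ) [IsFiniteMeasure μ] {ν : ℝ} (hν : 0 < ν)
    (ω : ℝ) :
    Integrable (Function.uncurry fun (t ξ : ℝ) =>
        ((Real.exp (-(ν * t)) : ℝ) : ℂ) * cexp (-(I * ((ω * t : ℝ) : ℂ))) * cexp (((ξ * t : ℝ) : ℂ) * I))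
      ((volume.restrict (Ioi (0:ℝ))).prod μ) := by
  have hexp : Integrable (fun t : ℝ => Real.exp (-(ν * t))) (volume.restrict (Ioi (0:ℝ))) := by
    have h : IntegrableOn (fun t : ℝ => Real.exp (-ν * t)) (Ioi 0) := exp_neg_integrableOn_Ioi 0 hν
    refine IntegrableOn.congr_fun h (fun t _ => ?_) measurableSet_Ioi
    simp only [neg_mul]
  have h1 : Integrable (fun z : ℝ × ℝ => Real.exp (-(ν * z.1)) * (1 : ℝ))
      ((volume.restrict (Ioi (0:ℝ))).prod μ) := hexp.mul_prod (integrable_const (1 : ℝ))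
  refine h1.mono' (Continuous.aestronglyMeasurable (by fun_prop)) (ae_of_all _ (fun z => ?_))
  change ‖((Real.exp (-(ν * z.1)) : ℝ) : ℂ) * cexp (-(I * ((ω * z.1 : ℝ) : ℂ))) *
      cexp (((z.2 * z.1 : ℝ) : ℂ) * I)‖ ≤ Real.exp (-(ν * z.1)) * 1
  rw [norm_mul, norm_mul, mul_one, Complex.norm_real, Complex.norm_exp, Complex.norm_exp,
    Real.norm_eq_abs, abs_of_pos (Real.exp_pos _)]
  have h2 : (-(I * ((ω * z.1 : ℝ) : ℂ))).re = 0 := by simp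
  have h3 : ((((z.2 * z.1 : ℝ) : ℂ)) * I).re = 0 := by simp
  rw [h2, h3, Real.exp_zero, mul_one, mul_one]

/-- **Spectral form of the Laplace–Fourier transform of a matrix coefficient** (Fubini over the
Stone–Bochner spectral measure): for `ν > 0`,
`∫₀^∞ e^{-νt} e^{-iωt} ⟪ψ, U_t ψ⟫ dt = ∫ dμ_ψ(ξ) / (ν + i(ω - ξ))`
(`= i ⟨ψ, (H - (ω - iν))⁻¹ ψ⟩` in spectral-theorem language). [folklore] -/
theorem laplaceFourier_inner_eq_integral_specMeasure (U : OneParameterUnitaryGroup H) (ψ : H)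
    {ν : ℝ} (hν : 0 < ν) (ω : ℝ) :
    ∫ t in Ioi (0:ℝ), ((Real.exp (-(ν * t)) : ℝ) : ℂ) * cexp (-(I * ((ω * t : ℝ) : ℂ))) *
        ⟪ψ, U.appReal t ψ⟫_ℂ =
      ∫ ξ, 1 / ((ν : ℂ) + I * ((ω - ξ : ℝ) : ℂ)) ∂(specMeasure U ψ) := by
  have hint := integrable_laplace_kernel_prod (specMeasure U ψ) hν ω
  calc ∫ t in Ioi (0:ℝ), ((Real.exp (-(ν * t)) : ℝ) : ℂ) * cexp (-(I * ((ω * t : ℝ) : ℂ))) *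
          ⟪ψ, U.appReal t ψ⟫_ℂ
      = ∫ t in Ioi (0:ℝ), ∫ ξ, ((Real.exp (-(ν * t)) : ℝ) : ℂ) * cexp (-(I * ((ω * t : ℝ) : ℂ))) *
          cexp (((ξ * t : ℝ) : ℂ) * I) ∂(specMeasure U ψ) := by
        refine setIntegral_congr_fun measurableSet_Ioi (fun t _ => ?_)
        rw [inner_appReal_eq_integral_specMeasure, ← integral_const_mul]
    _ = ∫ ξ, (∫ t in Ioi (0:ℝ), ((Real.exp (-(ν * t)) : ℝ) : ℂ) * cexp (-(I * ((ω * t : ℝ) : ℂ))) *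
          cexp (((ξ * t : ℝ) : ℂ) * I)) ∂(specMeasure U ψ) :=
        integral_integral_swap hint
    _ = ∫ ξ, 1 / ((ν : ℂ) + I * ((ω - ξ : ℝ) : ℂ)) ∂(specMeasure U ψ) :=
        integral_congr_ae (ae_of_all _ fun ξ => integral_Ioi_exp_neg_mul_cexp ν ω ξ hν)

/-- The Cauchy kernel `1 / (ν + i(ω - ξ))` is bounded by `1/ν` for `ν > 0`. [folklore] -/
theorem norm_one_div_cauchy_le {ν : ℝ} (hν : 0 < ν) (ω ξ : ℝ) :
    ‖1 / ((ν : ℂ) + I * ((ω - ξ : ℝ) : ℂ))‖ ≤ 1 / ν := by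
  rw [norm_div, norm_one]
  refine one_div_le_one_div_of_le hν ?_
  calc ν = |((ν : ℂ) + I * ((ω - ξ : ℝ) : ℂ)).re| := by simp [abs_of_pos hν]
    _ ≤ ‖(ν : ℂ) + I * ((ω - ξ : ℝ) : ℂ)‖ := Complex.abs_re_le_norm _

/-- The Cauchy kernel is continuous in `ξ`. [folklore] -/
theorem continuous_one_div_cauchy {ν : ℝ} (hν : 0 < ν) (ω : ℝ) :
    Continuous fun ξ : ℝ => 1 / ((ν : ℂ) + I * ((ω - ξ : ℝ) : ℂ)) := by
  refine Continuous.div continuous_const (by fun_prop) (fun ξ h => ?_)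
  have := congrArg Complex.re h
  simp at this
  exact hν.ne' this

/-- The Cauchy kernel is integrable against any finite measure. [folklore] -/
theorem integrable_one_div_cauchy (μ : Measure ℝ) [IsFiniteMeasure μ] {ν : ℝ} (hν : 0 < ν)
    (ω : ℝ) : Integrable (fun ξ : ℝ => 1 / ((ν : ℂ) + I * ((ω - ξ : ℝ) : ℂ))) μ :=
  Integrable.of_bound (continuous_one_div_cauchy hν ω).aestronglyMeasurable (1 / ν)
    (ae_of_all _ fun ξ => norm_one_div_cauchy_le hν ω ξ)

/-- Real part of the Cauchy kernel is the Poisson kernel: `Re (1/(ν + i(ω - ξ))) = ν / (ν² + (ω - ξ)²)`.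
[folklore] -/
theorem re_one_div_cauchy (ν ω ξ : ℝ) (hν : 0 < ν) :
    (1 / ((ν : ℂ) + I * ((ω - ξ : ℝ) : ℂ))).re = ν / (ν ^ 2 + (ω - ξ) ^ 2) := by
  have hne : (ν : ℂ) + I * ((ω - ξ : ℝ) : ℂ) ≠ 0 := fun h => by
    have := congrArg Complex.re h
    simp at this
    exact hν.ne' this
  rw [one_div, Complex.inv_re, Complex.normSq_apply]
  simp
  ring

/-- Imaginary part of the Cauchy kernel (conjugate Poisson kernel):
`Im (1/(ν + i(ω - ξ))) = (ξ - ω) / (ν² + (ω - ξ)²)`. [folklore] -/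
theorem im_one_div_cauchy (ν ω ξ : ℝ) :
    (1 / ((ν : ℂ) + I * ((ω - ξ : ℝ) : ℂ))).im = (ξ - ω) / (ν ^ 2 + (ω - ξ) ^ 2) := by
  rw [one_div, Complex.inv_im, Complex.normSq_apply]
  simp
  ring

/-- **The real part of the Laplace–Fourier transform is the Poisson integral of the spectral
measure**: `Re ∫₀^∞ e^{-νt} e^{-iωt} ⟪ψ, U_t ψ⟫ dt = ∫ ν / (ν² + (ω - ξ)²) dμ_ψ(ξ)`. [folklore] -/
theorem re_laplaceFourier_inner_eq_poisson (U : OneParameterUnitaryGroup H) (ψ : H)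
    {ν : ℝ} (hν : 0 < ν) (ω : ℝ) :
    (∫ t in Ioi (0:ℝ), ((Real.exp (-(ν * t)) : ℝ) : ℂ) * cexp (-(I * ((ω * t : ℝ) : ℂ))) *
        ⟪ψ, U.appReal t ψ⟫_ℂ).re =
      ∫ ξ, ν / (ν ^ 2 + (ω - ξ) ^ 2) ∂(specMeasure U ψ) := by
  rw [laplaceFourier_inner_eq_integral_specMeasure U ψ hν ω, ← RCLike.re_to_complex,
    ← integral_re (integrable_one_div_cauchy _ hν ω)]
  refine integral_congr_ae (ae_of_all _ fun ξ => ?_)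
  simp only [RCLike.re_to_complex]
  exact re_one_div_cauchy ν ω ξ hν

/-- **The imaginary part** (conjugate Poisson / principal-value part):
`Im ∫₀^∞ e^{-νt} e^{-iωt} ⟪ψ, U_t ψ⟫ dt = ∫ (ξ - ω) / (ν² + (ω - ξ)²) dμ_ψ(ξ)`. [folklore] -/
theorem im_laplaceFourier_inner_eq_conjPoisson (U : OneParameterUnitaryGroup H) (ψ : H)
    {ν : ℝ} (hν : 0 < ν) (ω : ℝ) :
    (∫ t in Ioi (0:ℝ), ((Real.exp (-(ν * t)) : ℝ) : ℂ) * cexp (-(I * ((ω * t : ℝ) : ℂ))) *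
        ⟪ψ, U.appReal t ψ⟫_ℂ).im =
      ∫ ξ, (ξ - ω) / (ν ^ 2 + (ω - ξ) ^ 2) ∂(specMeasure U ψ) := by
  rw [laplaceFourier_inner_eq_integral_specMeasure U ψ hν ω, ← RCLike.im_to_complex,
    ← integral_im (integrable_one_div_cauchy _ hν ω)]
  refine integral_congr_ae (ae_of_all _ fun ξ => ?_)
  simp only [RCLike.im_to_complex]
  exact im_one_div_cauchy ν ω ξ

/-! ## §2. The function `laplaceFourier` and the reductions of the conclusion of the stub -/

/-- The Laplace–Fourier transform `G_ν` abbreviating the conclusion of the stub: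
`laplaceFourier U ψ ν ω = ∫₀^∞ e^{-νt} e^{-iωt} ⟪ψ, U_t ψ⟫ dt`. [folklore] -/
def laplaceFourier (U : OneParameterUnitaryGroup H) (ψ : H) (ν ω : ℝ) : ℂ :=
  ∫ t in Ioi (0:ℝ), ((Real.exp (-(ν * t)) : ℝ) : ℂ) * cexp (-(I * ((ω * t : ℝ) : ℂ))) *
    ⟪ψ, U.appReal t ψ⟫_ℂ

/-- `G_ν(ω) = ∫ dμ_ψ(ξ) / (ν + i(ω - ξ))` (spectral form of `laplaceFourier`). [folklore] -/
theorem laplaceFourier_eq_integral_specMeasure (U : OneParameterUnitaryGroup H) (ψ : H) {ν : ℝ}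
    (hν : 0 < ν) (ω : ℝ) :
    laplaceFourier U ψ ν ω = ∫ ξ, 1 / ((ν : ℂ) + I * ((ω - ξ : ℝ) : ℂ)) ∂(specMeasure U ψ) :=
  laplaceFourier_inner_eq_integral_specMeasure U ψ hν ω

/-- **`G_ν` is continuous in `ω` for `ν > 0`** (dominated convergence on the spectral side, bound
`1/ν`). [folklore] -/
theorem continuous_laplaceFourier (U : OneParameterUnitaryGroup H) (ψ : H) {ν : ℝ} (hν : 0 < ν) :
    Continuous fun ω : ℝ => laplaceFourier U ψ ν ω := by
  have h : (fun ω : ℝ => laplaceFourier U ψ ν ω) =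
      fun ω => ∫ ξ, 1 / ((ν : ℂ) + I * ((ω - ξ : ℝ) : ℂ)) ∂(specMeasure U ψ) :=
    funext fun ω => laplaceFourier_eq_integral_specMeasure U ψ hν ω
  rw [h]
  refine continuous_of_dominated (bound := fun _ => 1 / ν) (fun ω => ?_) (fun ω => ?_) ?_ ?_
  · exact (continuous_one_div_cauchy hν ω).aestronglyMeasurable
  · exact ae_of_all _ fun ξ => norm_one_div_cauchy_le hν ω ξ
  · exact integrable_const _
  · refine ae_of_all _ fun ξ => ?_
    refine Continuous.div continuous_const (by fun_prop) (fun ω h => ?_)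
    have := congrArg Complex.re h
    simp at this
    exact hν.ne' this

/-- `‖G_ν(ω)‖ ≤ ‖ψ‖² / ν`. [folklore] -/
theorem norm_laplaceFourier_le (U : OneParameterUnitaryGroup H) (ψ : H) {ν : ℝ} (hν : 0 < ν)
    (ω : ℝ) : ‖laplaceFourier U ψ ν ω‖ ≤ ‖ψ‖ ^ 2 / ν := by
  rw [laplaceFourier_eq_integral_specMeasure U ψ hν ω]
  calc ‖∫ ξ, 1 / ((ν : ℂ) + I * ((ω - ξ : ℝ) : ℂ)) ∂(specMeasure U ψ)‖
      ≤ (1 / ν) * (specMeasure U ψ).real univ :=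
        norm_integral_le_of_norm_le_const (ae_of_all _ fun ξ => norm_one_div_cauchy_le hν ω ξ)
    _ = ‖ψ‖ ^ 2 / ν := by rw [specMeasure_real_univ]; ring

/-- **Continuity of the limit is automatic**: if `G_ν → G` uniformly on `S` as `ν ↓ 0`, then `G` is
continuous on `S` (uniform limit of the continuous `G_ν`). So the stub's `ContinuousOn G` clause
is implied by its `TendstoUniformlyOn` clause. [folklore] -/
theorem continuousOn_of_tendstoUniformlyOn_laplaceFourier (U : OneParameterUnitaryGroup H) (ψ : H)
    {G : ℝ → ℂ} {S : Set ℝ}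
    (h : TendstoUniformlyOn (fun ν ω => laplaceFourier U ψ ν ω) G (𝓝[>] (0:ℝ)) S) :
    ContinuousOn G S := by
  refine h.continuousOn (Filter.Eventually.frequently ?_)
  filter_upwards [self_mem_nhdsWithin] with ν hν
  exact (continuous_laplaceFourier U ψ hν).continuousOn

/-- **Cauchy criterion**: the stub's conclusion follows from the uniform Cauchy property of
`ν ↦ G_ν` on `S` as `ν ↓ 0` (completeness of `ℂ` gives the pointwise limits, the uniform limit is
then continuous). [folklore] -/
theorem exists_limit_of_uniformCauchySeqOn_laplaceFourier (U : OneParameterUnitaryGroup H) (ψ : H)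
    {S : Set ℝ} (h : UniformCauchySeqOn (fun ν ω => laplaceFourier U ψ ν ω) (𝓝[>] (0:ℝ)) S) :
    ∃ G : ℝ → ℂ, ContinuousOn G S ∧
      TendstoUniformlyOn (fun ν ω => laplaceFourier U ψ ν ω) G (𝓝[>] (0:ℝ)) S := by
  classical
  have hpt : ∀ ω ∈ S, ∃ z : ℂ, Tendsto (fun ν => laplaceFourier U ψ ν ω) (𝓝[>] (0:ℝ)) (𝓝 z) :=
    fun ω hω => cauchy_map_iff_exists_tendsto.1 (h.cauchy_map hω)
  choose! G hG using hpt
  have hu : TendstoUniformlyOn (fun ν ω => laplaceFourier U ψ ν ω) G (𝓝[>] (0:ℝ)) S :=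
    h.tendstoUniformlyOn_of_tendsto hG
  exact ⟨G, continuousOn_of_tendstoUniformlyOn_laplaceFourier U ψ hu, hu⟩

/-- **The stub, reduced**: to prove `stub_mourreThresholdLAP` it suffices to establish, under its
hypotheses, the uniform Cauchy property of `ν ↦ (ω ↦ ∫₀^∞ e^{-νt} e^{-iωt} ⟪ψ, U_t ψ⟫ dt)` on
`[l', r']` as `ν ↓ 0` — the analytic content of the limiting absorption principle. [folklore] -/
theorem stub_of_uniformCauchy :
    (∀ (K : Type) [NormedAddCommGroup K] [InnerProductSpace ℂ K] [CompleteSpace K]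
      (U A : Literature.Analysis.UnboundedOperators.OneParameterUnitaryGroup K) (l r a : ℝ),
      l < r → 0 < a → U.HamiltonianOfClassC1 A → U.HamiltonianOfClassC11 A →
      U.HasMourreEstimateOn A (Set.Ioo l r) a →
      ∀ ψ : K, ψ ∈ A.hamiltonian.domain →
        ∀ l' r' : ℝ, l < l' → l' ≤ r' → r' < r →
          UniformCauchySeqOn
            (fun (ν : ℝ) (ω : ℝ) =>
              MeasureTheory.integral (MeasureTheory.volume.restrict (Set.Ioi (0:ℝ)))
                (fun t : ℝ => ((Real.exp (-(ν * t)) : ℝ) : ℂ) *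
                  Complex.exp (-(Complex.I * ((ω * t : ℝ) : ℂ))) * ⟪ψ, U.appReal t ψ⟫_ℂ))
            (nhdsWithin (0:ℝ) (Set.Ioi 0)) (Set.Icc l' r')) →
    ∀ (K : Type) [NormedAddCommGroup K] [InnerProductSpace ℂ K] [CompleteSpace K]
      (U A : Literature.Analysis.UnboundedOperators.OneParameterUnitaryGroup K) (l r a : ℝ),
      l < r → 0 < a → U.HamiltonianOfClassC1 A → U.HamiltonianOfClassC11 A →
      U.HasMourreEstimateOn A (Set.Ioo l r) a →
      ∀ ψ : K, ψ ∈ A.hamiltonian.domain →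
        ∀ l' r' : ℝ, l < l' → l' ≤ r' → r' < r →
          ∃ G : ℝ → ℂ, ContinuousOn G (Set.Icc l' r') ∧
            TendstoUniformlyOn
              (fun (ν : ℝ) (ω : ℝ) =>
                MeasureTheory.integral (MeasureTheory.volume.restrict (Set.Ioi (0:ℝ)))
                  (fun t : ℝ => ((Real.exp (-(ν * t)) : ℝ) : ℂ) *
                    Complex.exp (-(Complex.I * ((ω * t : ℝ) : ℂ))) * ⟪ψ, U.appReal t ψ⟫_ℂ))
              G (nhdsWithin (0:ℝ) (Set.Ioi 0)) (Set.Icc l' r') := by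
  intro hLAP K _ _ _ U A l r a hlr ha hC1 hC11 hM ψ hψ l' r' hl hl' hr
  exact exists_limit_of_uniformCauchySeqOn_laplaceFourier U ψ
    (hLAP K U A l r a hlr ha hC1 hC11 hM ψ hψ l' r' hl hl' hr)

/-! ## §3. The resolvent kernel and `resolventAt U z = (H - z)⁻¹`, `Im z ≠ 0`, through the group -/

/-- The resolvent kernel at a non-real `z`: for `Im z < 0`, `k_z(t) = -i e^{-izt}` for `t ≥ 0` and
`0` for `t < 0`, so that `∫ k_z(t) e^{itH} dt = -i ∫₀^∞ e^{it(H - z)} dt = (H - z)⁻¹` (the tree's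
`resolventKernel` is the case `z = -i`); for `Im z > 0`, `k_z(t) = i e^{-izt}` for `t ≤ 0` and `0`
for `t > 0`, so that `∫ k_z(t) e^{itH} dt = i ∫_{-∞}^0 e^{it(H - z)} dt = (H - z)⁻¹`. The two are
related by `k_{z̄}(t) = conj (k_z(-t))` (the adjoint kernel, `R(z)* = R(z̄)`). For real `z` the
(second) formula is not integrable and `resolventAt` below takes the junk value `0`. [folklore] -/
def resolventKernelAt (z : ℂ) (t : ℝ) : ℂ :=
  if z.im < 0 then (if 0 ≤ t then -I * cexp (-(I * z * t)) else 0)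
  else (if t ≤ 0 then I * cexp (-(I * z * t)) else 0)

/-- The smooth kernel `t ↦ -i e^{-izt}`; for `Im z < 0` its restriction to `t ≥ 0` is
`resolventKernelAt z`, for `Im z > 0` the restriction of `-negIExpAt z` to `t ≤ 0` is. [folklore] -/
def negIExpAt (z : ℂ) (t : ℝ) : ℂ := -I * cexp (-(I * z * t))

/-- `resolventKernelAt z = 𝟙_{[0,∞)} · negIExpAt z` for `Im z < 0`. [folklore] -/
theorem resolventKernelAt_eq_indicator {z : ℂ} (hz : z.im < 0) :
    resolventKernelAt z = (Set.Ici (0 : ℝ)).indicator (negIExpAt z) := by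
  funext t
  simp only [resolventKernelAt, if_pos hz, negIExpAt, Set.indicator_apply, Set.mem_Ici]

/-- `resolventKernelAt z = -𝟙_{(-∞,0]} · negIExpAt z` for `Im z ≥ 0`. [folklore] -/
theorem resolventKernelAt_eq_indicator_of_nonneg {z : ℂ} (hz : 0 ≤ z.im) :
    resolventKernelAt z = (Set.Iic (0 : ℝ)).indicator (fun t => -negIExpAt z t) := by
  funext t
  simp only [resolventKernelAt, if_neg (not_lt.2 hz), negIExpAt, Set.indicator_apply, Set.mem_Iic,
    neg_mul, neg_neg]

/-- `‖-i e^{-izt}‖ = e^{(Im z) t}`. [folklore] -/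
theorem norm_negIExpAt (z : ℂ) (t : ℝ) : ‖negIExpAt z t‖ = Real.exp (z.im * t) := by
  rw [negIExpAt, norm_mul, norm_neg, Complex.norm_I, one_mul, Complex.norm_exp]
  congr 1
  simp [Complex.mul_re, Complex.mul_im]

/-- `negIExpAt z` is continuous. [folklore] -/
theorem continuous_negIExpAt (z : ℂ) : Continuous (negIExpAt z) := by
  unfold negIExpAt; fun_prop

/-- `d/dt (-i e^{-izt}) = (-iz) · (-i e^{-izt})`. [folklore] -/
theorem hasDerivAt_negIExpAt (z : ℂ) (t : ℝ) :
    HasDerivAt (negIExpAt z) ((-(I * z)) * negIExpAt z t) t := by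
  have h1 : HasDerivAt (fun s : ℝ => -(I * z * (s : ℂ))) (-(I * z)) t := by
    have := ((hasDerivAt_id (t : ℂ)).const_mul (I * z)).neg.comp_ofReal
    simpa using this
  have h2 := (h1.cexp).const_mul (-I)
  refine h2.congr_deriv ?_
  simp only [negIExpAt]
  ring

/-- The resolvent kernel is integrable for `Im z < 0` (`‖k_z(t)‖ = e^{(Im z)t}` on `t ≥ 0`).
[folklore] -/
theorem integrable_resolventKernelAt {z : ℂ} (hz : z.im < 0) : Integrable (resolventKernelAt z) := by
  -- adapted from `UnitaryRep.integrable_resolventKernel`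
  have h1 : IntegrableOn (negIExpAt z) (Set.Ici 0) := by
    rw [integrableOn_Ici_iff_integrableOn_Ioi]
    have h : IntegrableOn (fun t : ℝ => Real.exp (z.im * t)) (Ioi 0) := by
      have := exp_neg_integrableOn_Ioi 0 (neg_pos.2 hz)
      refine IntegrableOn.congr_fun this (fun t _ => ?_) measurableSet_Ioi
      simp
    refine Integrable.mono' h (continuous_negIExpAt z).aestronglyMeasurable
      (ae_of_all _ fun t => (norm_negIExpAt z t).le)
  rw [resolventKernelAt_eq_indicator hz]
  exact h1.integrable_indicator measurableSet_Ici

/-- **The resolvent `(H - z)⁻¹` through the group** as a bounded operator, smearing the group with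
`resolventKernelAt z`: `-i ∫₀^∞ e^{-izt} e^{itH} dt` for `Im z < 0`, `i ∫_{-∞}^0 e^{-izt} e^{itH} dt`
for `Im z > 0` (Laplace transform of the group; the tree's `resolventNegI` is the case `z = -i`);
junk value `0` for real `z`. [folklore] -/
def resolventAt (U : OneParameterUnitaryGroup H) (z : ℂ) : H →L[ℂ] H :=
  U.smear (resolventKernelAt z)

end Summit.AtomisticToContinuum.FouriersLaw.Theorems.MourreDissolution
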